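import Literature.NumberTheory.LFunctions.IdealMoebius
import HarnessLib

/-!
# Möbius sums over the ideals coprime to a fixed ideal, with de la Vallée-Poussin error term
# (the sum `Σ` of Heath-Brown's (8.7), for a general number field)

Topic `Literature/NumberTheory/LFunctions`, companion of `IdealMoebius.lean` (the Möbius function
`idealMoebius` on the ideals of a Dedekind domain, `∑ μ_K(J)N(J)^{-s} = 1/ζ_K(s)`) and
`RieszMeanInvDedekindZeta.lean` (logarithmic Riesz means of the coefficients of `H(s)/ζ_K(s)`).
Everything in this file is PROVED (theorems only; no definitions, no named facts).

D. R. Heath-Brown, *Primes represented by `x³ + 2y³`*, Acta Math. 186 (2001), p. 51, in the proof of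
Lemma 8.1, evaluates for an ideal `C` of `K = ℚ(2^{1/3})` and `x ≥ N(C)` the sum
`Σ = ∑_{N(B) < x, (B,C)=1} μ(B) N(B)^{-1} log(x/N(B))` through the Dirichlet series
`f(s) = ∑_{(B,C)=1} μ(B)N(B)^{-s} = ζ_K(s)^{-1} ∏_{P∣C}(1 − N(P)^{-s})^{-1}`: "The Perron formula shows
that `Σ = (1/2πi)∫_{1−i∞}^{1+i∞} f(s+1) x^s s^{-2} ds` … Using the standard zero-free region for
`ζ_K(s)` we may therefore change the path of integration in the usual way to obtain
`Σ = res{f(s+1)x^s s^{-2} : s = 0} + O(exp{−c√(log x)})` … The residue is easily found to be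
`γ₀^{-1}∏_{P∣C}(1 − N(P)^{-1})^{-1}`." This file proves that evaluation for every number field `K`
and every nonzero ideal `𝔠`, uniformly (`NumberField.coprimeMoebius_logRieszMean_bound`):
`|Σ − ρ_K^{-1}∏_{P∣𝔠}(1 − N(P)^{-1})^{-1}| ≤ C_K · B(𝔠) · exp(−c_K√(log x))` for all `x ≥ 1`, with
`B(𝔠) = ∏_{p ∣ N(𝔠)} ∑_e c_K(p^e) p^{-e/2} ≤ A_K^{ω(N(𝔠))}`.

## Contents (namespaces `Literature.NumberTheory.LFunctions`, `….NumberField`)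

* `dvd_and_sup_eq_top_iff`, **`sum_filter_idealMoebius_eq`** — Möbius inversion with a coprimality
  condition in a Dedekind domain: `∑_{B ∣ J, B + 𝔠 = (1)} μ(B) = [every prime factor of J divides 𝔠]`
  (the coprime divisors of `J` are the divisors of its `𝔠`-coprime part);
* **`hasSum_absNorm_rpow_neg_supported`** — the finite Euler product
  `∑_{supp D ⊆ T} N(D)^{-σ} = ∏_{P ∈ T}(1 − N(P)^{-σ})^{-1}` (`σ > 0`) over the ideals supported on a
  finite set `T` of primes (induction on `T` with the bijection `ℕ × Supp[T] ≃ Supp[insert P T]`,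
  `(n, D') ↦ P^n D'`, the ideal analogue of Mathlib's `Nat.equivProdNatFactoredNumbers`), and its
  `ℕ`-grouped form `hasSum_card_supported_mul_rpow`, `LSeries_supportedCount_one`;
* `sum_divisorsAntidiagonal_regroup`, **`sum_divisorsAntidiagonal_coprimeMoebius_mul`**,
  **`LSeries_coprimeMoebiusSum_mul_dedekindZeta`** — with `a_𝔠(n) = ∑_{N(B)=n, B+𝔠=(1)} μ(B)` and
  `h_𝔠(n) = #{D : N(D) = n, every prime factor of D divides 𝔠}`: `a_𝔠 ⋆ c_K = h_𝔠`, i.e.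
  `(∑ a_𝔠(n)n^{-s})·ζ_K(s) = ∑ h_𝔠(n) n^{-s}` (`Re s > 1`) — Heath-Brown's identity for `f(s)`;
* `tsum_norm_term_supportedCount_le`, `localFactor_le`, `prod_localFactor_le_pow` — the size of the
  numerator on `Re s = 1/2` through Mathlib's Euler product over `factoredNumbers`;
* **`coprimeMoebius_logRieszMean_bound`** (from `NumberField.logRieszMean_LSeries_div_dedekindZeta_bound`)
  and the regrouping `sum_Icc_coprimeMoebiusSum_mul_eq` as a sum over ideals.

## References

* D. R. Heath-Brown, *Primes represented by `x³ + 2y³`*, Acta Math. 186 (2001), 1–84: §8, p. 51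
  ((8.7) and the sum `Σ`). [cite: HeathBrownActa2001, §8 p. 51]
* H. L. Montgomery, R. C. Vaughan, *Multiplicative Number Theory I*, CUP 2007, §6.2.
  [cite: MontgomeryVaughan2007, §6.2]

## Mathlib / tree search

Mathlib: `EulerProduct.summable_and_hasSum_factoredNumbers_prod_filter_prime_tsum`,
`Nat.factoredNumbers`, `HasSum.tsum_fiberwise`, `HasSum.mul`, `hasSum_geometric_of_lt_one`,
`summable_pow_mul_geometric_of_norm_lt_one`, `Ideal.exists_le_maximal`,
`UniqueFactorizationMonoid.mem_normalizedFactors_iff`, `Multiset.filter_eq'`, `tsum_const`,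
`Equiv.subtypeSubtypeEquivSubtypeInter`. Tree: `idealMoebius`, `sum_idealMoebius_of_dvd`,
`idealsOfNorm`, `idealNormCount_mul_of_coprime`, `idealNormCount_prime_pow_le`,
`LSeries_natCast_ofReal`, `NumberField.logRieszMean_LSeries_div_dedekindZeta_bound`; nothing on
Möbius sums over ideals coprime to a given ideal (`lean search 'coprime.*moebius|Coprime.*Ideal.*sum'`).
-/

noncomputable section

open UniqueFactorizationMonoid Finset
open scoped NumberField

namespace Literature.NumberTheory.LFunctions

/-! ## Möbius sums over the divisors coprime to a fixed ideal -/

section Coprime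

variable {R : Type*} [CommRing R] [IsDedekindDomain R]

open scoped Classical in
/-- For nonzero ideals `J, 𝔠` of a Dedekind domain, with `J' = ∏_{P ∈ normalizedFactors J, P ∤ 𝔠} P`
the `𝔠`-coprime part of `J`: a divisor `B` of `J` is coprime to `𝔠` (`B + 𝔠 = (1)`) iff `B ∣ J'`.
[folklore] -/
theorem dvd_and_sup_eq_top_iff {J 𝔠 B : Ideal R} (hJ : J ≠ ⊥) (h𝔠 : 𝔠 ≠ ⊥) :
    (B ∣ J ∧ B ⊔ 𝔠 = ⊤) ↔ B ∣ ((normalizedFactors J).filter (fun P ↦ ¬P ∣ 𝔠)).prod := by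
  have hJ0 : (J : Ideal R) ≠ 0 := by rwa [Ne, Ideal.zero_eq_bot]
  set F := normalizedFactors J with hF
  set F' := F.filter (fun P ↦ ¬P ∣ 𝔠) with hF'
  have hFp : ∀ Q ∈ F, Prime Q := fun Q hQ ↦ prime_of_normalized_factor Q hQ
  have hF'p : ∀ Q ∈ F', Prime Q := fun Q hQ ↦ hFp Q (Multiset.mem_of_mem_filter hQ)
  have hJ'0 : F'.prod ≠ 0 := Multiset.prod_ne_zero fun h ↦ (hF'p 0 h).ne_zero rfl
  have hnfJ' : normalizedFactors F'.prod = F' := normalizedFactors_prod_of_prime hF'p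
  have hJ'J : F'.prod ∣ J := by
    have h1 : F'.prod ∣ F.prod := Multiset.prod_dvd_prod_of_le (Multiset.filter_le _ _)
    rwa [associated_iff_eq.1 (prod_normalizedFactors hJ0)] at h1
  constructor
  · rintro ⟨hBJ, hBc⟩
    have hB0 : B ≠ 0 := fun h ↦ hJ0 (zero_dvd_iff.1 (h ▸ hBJ))
    rw [dvd_iff_normalizedFactors_le_normalizedFactors hB0 hJ'0, hnfJ', Multiset.le_iff_count]
    intro Q
    by_cases hQc : ¬Q ∣ 𝔠
    · rw [hF', Multiset.count_filter_of_pos (p := fun P ↦ ¬P ∣ 𝔠) hQc]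
      exact Multiset.le_iff_count.1
        ((dvd_iff_normalizedFactors_le_normalizedFactors hB0 hJ0).1 hBJ) Q
    · push Not at hQc
      have hQB : Q ∉ normalizedFactors B := by
        intro hQ
        have hQp : Prime Q := prime_of_normalized_factor Q hQ
        have hQB' : B ≤ Q := Ideal.le_of_dvd (dvd_of_mem_normalizedFactors hQ)
        have hQc' : 𝔠 ≤ Q := Ideal.le_of_dvd hQc
        have hQtop : Q ≠ ⊤ := fun h ↦ hQp.not_unit (by rw [Ideal.isUnit_iff]; exact h)
        exact hQtop (top_le_iff.1 (hBc ▸ sup_le hQB' hQc'))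
      rw [Multiset.count_eq_zero.2 hQB]
      exact Nat.zero_le _
  · intro hBJ'
    refine ⟨hBJ'.trans hJ'J, ?_⟩
    by_contra hne
    obtain ⟨M, hMmax, hBM⟩ := Ideal.exists_le_maximal _ hne
    have hcM : 𝔠 ≤ M := le_sup_right.trans hBM
    have hBM' : B ≤ M := le_sup_left.trans hBM
    have hM0 : M ≠ ⊥ := fun h ↦ h𝔠 (le_bot_iff.1 (h ▸ hcM))
    have hMp : Prime M := Ideal.prime_of_isPrime hM0 hMmax.isPrime
    have hMJ' : M ∣ F'.prod := (Ideal.dvd_iff_le.2 hBM').trans hBJ'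
    have hMF' : M ∈ F' := by
      rw [← hnfJ']
      exact (UniqueFactorizationMonoid.mem_normalizedFactors_iff hJ'0).2 ⟨hMp, hMJ'⟩
    exact (Multiset.mem_filter.1 hMF').2 (Ideal.dvd_iff_le.2 hcM)

open scoped Classical in
/-- **Möbius inversion with a coprimality condition**: for nonzero ideals `J, 𝔠` of a Dedekind
domain and any finset `D` consisting of the divisors of `J`,
`∑_{B ∣ J, B + 𝔠 = (1)} μ(B) = 1` if every prime factor of `J` divides `𝔠`, and `= 0` otherwise
(apply `sum_idealMoebius_of_dvd` to the `𝔠`-coprime part of `J`). This is the "multiplicativity"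
behind Heath-Brown's evaluation of (8.7). [cite: HeathBrownActa2001, §8 p. 51] -/
theorem sum_filter_idealMoebius_eq {J 𝔠 : Ideal R} (hJ : J ≠ ⊥) (h𝔠 : 𝔠 ≠ ⊥) {D : Finset (Ideal R)}
    (hD : ∀ B, B ∈ D ↔ B ∣ J) :
    ∑ B ∈ D.filter (fun B ↦ B ⊔ 𝔠 = ⊤), idealMoebius B =
      if ∀ P ∈ normalizedFactors J, P ∣ 𝔠 then 1 else 0 := by
  classical
  have hJ0 : (J : Ideal R) ≠ 0 := by rwa [Ne, Ideal.zero_eq_bot]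
  set F' := (normalizedFactors J).filter (fun P ↦ ¬P ∣ 𝔠) with hF'
  have hF'p : ∀ Q ∈ F', Prime Q := fun Q hQ ↦
    prime_of_normalized_factor Q (Multiset.mem_of_mem_filter hQ)
  have hJ'0 : F'.prod ≠ ⊥ := by
    rw [Ne, ← Ideal.zero_eq_bot]
    exact Multiset.prod_ne_zero fun h ↦ (hF'p 0 h).ne_zero rfl
  have hmem : ∀ B, B ∈ D.filter (fun B ↦ B ⊔ 𝔠 = ⊤) ↔ B ∣ F'.prod := fun B ↦ by
    rw [Finset.mem_filter, hD]
    convert dvd_and_sup_eq_top_iff (B := B) hJ h𝔠 using 2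
  rw [sum_idealMoebius_of_dvd hJ'0 hmem]
  have hiff : F'.prod = ⊤ ↔ ∀ P ∈ normalizedFactors J, P ∣ 𝔠 := by
    constructor
    · intro h P hP
      by_contra hPc
      have hPF' : P ∈ F' := Multiset.mem_filter.2 ⟨hP, hPc⟩
      have : P ∈ normalizedFactors F'.prod := by
        rw [normalizedFactors_prod_of_prime hF'p]; exact hPF'
      rw [h, ← Ideal.one_eq_top, normalizedFactors_one] at this
      simp at this
    · intro h
      have : F' = 0 := Multiset.filter_eq_nil.2 fun P hP hPc ↦ hPc (h P hP)
      rw [this, Multiset.prod_zero, Ideal.one_eq_top]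
  by_cases h : ∀ P ∈ normalizedFactors J, P ∣ 𝔠
  · rw [if_pos (hiff.2 h), if_pos h]
  · rw [if_neg (fun h' ↦ h (hiff.1 h')), if_neg h]

end Coprime

/-! ## Finite Euler products over the ideals supported on a finite set of primes -/

namespace NumberField

open LSeries UniqueFactorizationMonoid
open scoped LSeries.notation

variable (K : Type*) [Field K] [NumberField K]

/-- Local notation: the nonzero ideals all of whose prime factors lie in `T`. -/
local notation3 "Supp[" T "]" =>
  {D : Ideal (𝓞 K) | D ≠ ⊥ ∧ ∀ Q ∈ normalizedFactors D, Q ∈ T}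

variable {K}

/-- `(1)` is `T`-supported. [folklore] -/
theorem top_mem_supported (T : Finset (Ideal (𝓞 K))) : (⊤ : Ideal (𝓞 K)) ∈ Supp[T] := by
  refine ⟨by simp, fun Q hQ ↦ ?_⟩
  rw [← Ideal.one_eq_top, normalizedFactors_one] at hQ
  simp at hQ

/-- The only `∅`-supported ideal is `(1)`. [folklore] -/
theorem supported_empty_eq : Supp[(∅ : Finset (Ideal (𝓞 K)))] = {⊤} := by
  ext D
  simp only [Finset.notMem_empty, imp_false, Set.mem_setOf_eq, Set.mem_singleton_iff]
  constructor
  · rintro ⟨hD0, hno⟩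
    have hD0' : (D : Ideal (𝓞 K)) ≠ 0 := by rwa [Ne, Ideal.zero_eq_bot]
    have h0 : normalizedFactors D = 0 := Multiset.eq_zero_of_forall_notMem hno
    by_contra hu
    have hpos := (normalizedFactors_pos D hD0').2 (by rwa [Ideal.isUnit_iff])
    rw [h0] at hpos
    exact lt_irrefl _ hpos
  · rintro rfl
    have h := top_mem_supported (K := K) ∅
    simpa using h

/-- A nonzero prime ideal of `𝓞 K` has norm `≥ 2`. [folklore] -/
theorem two_le_absNorm_of_prime {P : Ideal (𝓞 K)} (hP : Prime P) : 2 ≤ Ideal.absNorm P := by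
  have h0 : Ideal.absNorm P ≠ 0 := by
    rw [Ne, Ideal.absNorm_eq_zero_iff, ← Ideal.zero_eq_bot]; exact hP.ne_zero
  have h1 : Ideal.absNorm P ≠ 1 := by
    rw [Ne, Ideal.absNorm_eq_one_iff]
    intro h; exact hP.not_unit (by rwa [Ideal.isUnit_iff])
  omega

section Insert

variable {T : Finset (Ideal (𝓞 K))} {P : Ideal (𝓞 K)}

/-- Normalized factors of `P^n · D'`: `n` copies of `P` followed by those of `D'`. [folklore] -/
theorem normalizedFactors_pow_mul (hP : Prime P) {D' : Ideal (𝓞 K)} (hD' : D' ≠ ⊥) (n : ℕ) :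
    normalizedFactors (P ^ n * D') = Multiset.replicate n P + normalizedFactors D' := by
  have hP0 : P ≠ 0 := hP.ne_zero
  have hD'0 : (D' : Ideal (𝓞 K)) ≠ 0 := by rwa [Ne, Ideal.zero_eq_bot]
  rw [normalizedFactors_mul (pow_ne_zero n hP0) hD'0, normalizedFactors_pow,
    normalizedFactors_irreducible hP.irreducible]
  simp [Multiset.nsmul_singleton]

/-- `P^n · D'` is `insert P T`-supported when `D'` is `T`-supported. [folklore] -/
theorem pow_mul_mem_supported_insert (hP : Prime P) (n : ℕ) {D' : Ideal (𝓞 K)} (hD' : D' ∈ Supp[T]) :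
    P ^ n * D' ∈ Supp[insert P T] := by
  obtain ⟨hD'0, hsupp⟩ := hD'
  refine ⟨?_, fun Q hQ ↦ ?_⟩
  · rw [Ne, ← Ideal.zero_eq_bot, mul_eq_zero, not_or]
    exact ⟨pow_ne_zero n hP.ne_zero, by rwa [Ideal.zero_eq_bot]⟩
  · rw [normalizedFactors_pow_mul hP hD'0, Multiset.mem_add, Multiset.mem_replicate] at hQ
    rcases hQ with ⟨-, rfl⟩ | hQ
    · exact Finset.mem_insert_self _ _
    · exact Finset.mem_insert_of_mem (hsupp Q hQ)

/-- The `P`-free part `∏_{Q ≠ P} Q` (with multiplicity) of an `insert P T`-supported ideal is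
`T`-supported (`P ∉ T` is not needed here). [folklore] -/
theorem filter_prod_mem_supported {D : Ideal (𝓞 K)} (hD : D ∈ Supp[insert P T]) :
    ((normalizedFactors D).filter (· ≠ P)).prod ∈ Supp[T] := by
  classical
  obtain ⟨hD0, hsupp⟩ := hD
  have hprime : ∀ Q ∈ (normalizedFactors D).filter (· ≠ P), Prime Q := fun Q hQ ↦
    prime_of_normalized_factor Q (Multiset.mem_of_mem_filter hQ)
  refine ⟨?_, fun Q hQ ↦ ?_⟩
  · rw [Ne, ← Ideal.zero_eq_bot]
    exact Multiset.prod_ne_zero fun h ↦ (hprime 0 h).ne_zero rfl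
  · rw [normalizedFactors_prod_of_prime hprime, Multiset.mem_filter] at hQ
    have := hsupp Q hQ.1
    rw [Finset.mem_insert] at this
    exact this.resolve_left hQ.2

/-- Reassembling: `P^{v_P(D)} · ∏_{Q ≠ P} Q = D`. [folklore] -/
theorem pow_count_mul_filter_prod {D : Ideal (𝓞 K)} (hD0 : D ≠ ⊥) :
    P ^ (normalizedFactors D).count P * ((normalizedFactors D).filter (· ≠ P)).prod = D := by
  classical
  have hD0' : (D : Ideal (𝓞 K)) ≠ 0 := by rwa [Ne, Ideal.zero_eq_bot]
  conv_rhs => rw [← associated_iff_eq.1 (prod_normalizedFactors hD0'),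
    ← Multiset.filter_add_not (· = P) (normalizedFactors D), Multiset.prod_add]
  congr 1
  rw [Multiset.filter_eq', Multiset.prod_replicate]

/-- For `P ∉ T` prime: `v_P(P^n D') = n` and the `P`-free part of `P^n D'` is `D'` (`D'`
`T`-supported). [folklore] -/
theorem count_and_filter_pow_mul (hP : Prime P) (hPT : P ∉ T) (n : ℕ) {D' : Ideal (𝓞 K)}
    (hD' : D' ∈ Supp[T]) :
    (normalizedFactors (P ^ n * D')).count P = n ∧
      ((normalizedFactors (P ^ n * D')).filter (· ≠ P)).prod = D' := by
  classical
  obtain ⟨hD'0, hsupp⟩ := hD'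
  have hPn : P ∉ normalizedFactors D' := fun h ↦ hPT (hsupp P h)
  have hnf := normalizedFactors_pow_mul hP hD'0 n
  have hD'0' : (D' : Ideal (𝓞 K)) ≠ 0 := by rwa [Ne, Ideal.zero_eq_bot]
  refine ⟨?_, ?_⟩
  · rw [hnf, Multiset.count_add, Multiset.count_replicate_self, Multiset.count_eq_zero.2 hPn,
      add_zero]
  · have hf1 : (Multiset.replicate n P).filter (· ≠ P) = 0 :=
      Multiset.filter_eq_nil.2 fun Q hQ h ↦ h (Multiset.eq_of_mem_replicate hQ)
    have hf2 : (normalizedFactors D').filter (· ≠ P) = normalizedFactors D' :=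
      Multiset.filter_eq_self.2 fun Q hQ h ↦ hPn (h ▸ hQ)
    rw [hnf, Multiset.filter_add, hf1, zero_add, hf2]
    exact associated_iff_eq.1 (prod_normalizedFactors hD'0')

end Insert

/-- **Finite Euler product over `T`-supported ideals**: for a finite set `T` of prime ideals and
`σ > 0`, `∑_{D : supp D ⊆ T} N(D)^{-σ} = ∏_{P ∈ T} (1 − N(P)^{-σ})^{-1}` (absolutely convergent
`HasSum`; induction on `T` with `ℕ × Supp[T] ≃ Supp[insert P T]` and the geometric series).
[folklore] -/
theorem hasSum_absNorm_rpow_neg_supported {σ : ℝ} (hσ : 0 < σ) (T : Finset (Ideal (𝓞 K)))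
    (hT : ∀ P ∈ T, Prime P) :
    HasSum (fun D : Supp[T] ↦ (Ideal.absNorm (D : Ideal (𝓞 K)) : ℝ) ^ (-σ))
      (∏ P ∈ T, (1 - (Ideal.absNorm P : ℝ) ^ (-σ))⁻¹) := by
  classical
  induction T using Finset.induction_on with
  | empty =>
    rw [Finset.prod_empty]
    have h1 : (fun D : Supp[(∅ : Finset (Ideal (𝓞 K)))] ↦ (Ideal.absNorm (D : Ideal (𝓞 K)) : ℝ) ^ (-σ)) =
        fun _ ↦ 1 := by
      funext D
      have hD : (D : Ideal (𝓞 K)) = ⊤ :=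
        Set.mem_singleton_iff.1 ((Set.ext_iff.1 (supported_empty_eq (K := K)) D).1 D.2)
      rw [hD, Ideal.absNorm_top, Nat.cast_one, Real.one_rpow]
    rw [h1]
    have : Unique (Supp[(∅ : Finset (Ideal (𝓞 K)))]) := by
      rw [supported_empty_eq]; exact Set.uniqueSingleton ⊤
    simp
  | insert P T hPT ih =>
    have hP : Prime P := hT P (Finset.mem_insert_self _ _)
    have hT' : ∀ Q ∈ T, Prime Q := fun Q hQ ↦ hT Q (Finset.mem_insert_of_mem hQ)
    have ih' := ih hT'
    set r : ℝ := (Ideal.absNorm P : ℝ) ^ (-σ) with hr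
    have hNP : (2 : ℝ) ≤ Ideal.absNorm P := by exact_mod_cast two_le_absNorm_of_prime hP
    have hr0 : 0 ≤ r := Real.rpow_nonneg (by linarith) _
    have hr1 : r < 1 := Real.rpow_lt_one_of_one_lt_of_neg (by linarith) (by linarith)
    have hgeom := hasSum_geometric_of_lt_one hr0 hr1
    rw [Finset.prod_insert hPT]
    -- the bijection `ℕ × Supp[T] ≃ Supp[insert P T]`, `(n, D') ↦ P^n D'` (unique factorisation; the
    -- ideal analogue of Mathlib's `Nat.equivProdNatFactoredNumbers`)
    let e : ℕ × Supp[T] ≃ Supp[insert P T] :=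
      { toFun := fun x ↦ ⟨P ^ x.1 * (x.2 : Ideal (𝓞 K)), pow_mul_mem_supported_insert hP x.1 x.2.2⟩
        invFun := fun D ↦ ⟨(normalizedFactors (D : Ideal (𝓞 K))).count P,
          ⟨((normalizedFactors (D : Ideal (𝓞 K))).filter (· ≠ P)).prod,
            filter_prod_mem_supported D.2⟩⟩
        left_inv := by
          rintro ⟨n, D', hD'⟩
          obtain ⟨h1, h2⟩ := count_and_filter_pow_mul hP hPT n hD'
          ext1
          · exact h1
          · exact Subtype.ext h2
        right_inv := by
          rintro ⟨D, hD⟩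
          exact Subtype.ext (pow_count_mul_filter_prod hD.1) }
    have hfun : ((fun D : Supp[insert P T] ↦ (Ideal.absNorm (D : Ideal (𝓞 K)) : ℝ) ^ (-σ)) ∘ e) =
        fun x : ℕ × Supp[T] ↦ r ^ x.1 * (Ideal.absNorm (x.2 : Ideal (𝓞 K)) : ℝ) ^ (-σ) := by
      funext x
      simp only [Function.comp_apply, e, Equiv.coe_fn_mk, map_mul, map_pow,
        Nat.cast_mul, Nat.cast_pow]
      have h0 : (0 : ℝ) ≤ (Ideal.absNorm P : ℝ) := Nat.cast_nonneg _
      rw [Real.mul_rpow (by positivity) (by positivity), hr, ← Real.rpow_natCast_mul h0,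
        mul_comm ((x.1 : ℕ) : ℝ) (-σ), Real.rpow_mul_natCast h0]
    have hsumm : Summable fun x : ℕ × Supp[T] ↦
        r ^ x.1 * (Ideal.absNorm (x.2 : Ideal (𝓞 K)) : ℝ) ^ (-σ) :=
      Summable.mul_of_nonneg (f := fun n ↦ r ^ n)
        (g := fun D : Supp[T] ↦ (Ideal.absNorm (D : Ideal (𝓞 K)) : ℝ) ^ (-σ))
        hgeom.summable ih'.summable (fun n ↦ pow_nonneg hr0 n)
        (fun D ↦ Real.rpow_nonneg (Nat.cast_nonneg _) _)
    have hmul : HasSum (fun x : ℕ × Supp[T] ↦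
        r ^ x.1 * (Ideal.absNorm (x.2 : Ideal (𝓞 K)) : ℝ) ^ (-σ))
        ((1 - r)⁻¹ * ∏ P ∈ T, (1 - (Ideal.absNorm P : ℝ) ^ (-σ))⁻¹) :=
      hgeom.mul ih' hsumm
    -- transport along the bijection
    rw [← e.hasSum_iff, hfun]
    exact hmul

/-! ## The coefficients `a_𝔠 = μ·1_{(·,𝔠)=1}` grouped by norm, and `a_𝔠 ⋆ c_K = h_𝔠` -/

open scoped Classical in
/-- Regrouping the pairs `(B, A)` with `N(B)N(A) = n` as the pairs `(J, B)` with `N(J) = n`,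
`B ∣ J` (`J = BA`; cancellation of nonzero ideals): for any `φ`,
`∑_{ab=n} ∑_{N(B)=a} ∑_{N(A)=b} φ(BA, B) = ∑_{N(J)=n} ∑_{B ∣ J} φ(J, B)` (`n ≠ 0`). [folklore] -/
theorem sum_divisorsAntidiagonal_regroup (φ : Ideal (𝓞 K) → Ideal (𝓞 K) → ℤ) {n : ℕ}
    (hn : n ≠ 0) :
    ∑ p ∈ n.divisorsAntidiagonal, ∑ B ∈ idealsOfNorm K p.1, ∑ A ∈ idealsOfNorm K p.2, φ (B * A) B =
      ∑ J ∈ idealsOfNorm K n,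
        ∑ B ∈ ((Finset.Icc 1 (Ideal.absNorm J)).biUnion (idealsOfNorm K)).filter (· ∣ J),
          φ J B := by
  have hL : ∑ p ∈ n.divisorsAntidiagonal, ∑ B ∈ idealsOfNorm K p.1, ∑ A ∈ idealsOfNorm K p.2,
      φ (B * A) B =
      ∑ x ∈ n.divisorsAntidiagonal.sigma (fun p ↦ idealsOfNorm K p.1 ×ˢ idealsOfNorm K p.2),
        φ (x.2.1 * x.2.2) x.2.1 := by
    rw [Finset.sum_sigma]
    refine Finset.sum_congr rfl fun p _ ↦ ?_
    rw [Finset.sum_product]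
  set Dv : Ideal (𝓞 K) → Finset (Ideal (𝓞 K)) := fun J ↦
    ((Finset.Icc 1 (Ideal.absNorm J)).biUnion (idealsOfNorm K)).filter (· ∣ J) with hDv
  have hR : ∑ J ∈ idealsOfNorm K n, ∑ B ∈ Dv J, φ J B =
      ∑ y ∈ (idealsOfNorm K n).sigma Dv, φ y.1 y.2 := by
    rw [Finset.sum_sigma]
  rw [hL, hR]
  refine Finset.sum_bij (fun x _ ↦ ⟨x.2.1 * x.2.2, x.2.1⟩) ?_ ?_ ?_ ?_
  · rintro ⟨⟨a, b⟩, ⟨B, A⟩⟩ hx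
    simp only [Finset.mem_sigma, Nat.mem_divisorsAntidiagonal, Finset.mem_product,
      mem_idealsOfNorm] at hx
    obtain ⟨⟨hab, -⟩, hB, hA⟩ := hx
    have hJn : Ideal.absNorm (B * A) = n := by rw [map_mul, hB, hA, hab]
    have hJ0 : B * A ≠ ⊥ := by rw [Ne, ← Ideal.absNorm_eq_zero_iff, hJn]; exact hn
    simp only [Finset.mem_sigma, mem_idealsOfNorm, hJn, true_and, hDv]
    have := (mem_filter_dvd_iff hJ0).2 (dvd_mul_right B A)
    rwa [hJn] at this
  · rintro ⟨⟨a, b⟩, ⟨B, A⟩⟩ hx ⟨⟨a', b'⟩, ⟨B', A'⟩⟩ hx' h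
    simp only [Finset.mem_sigma, Nat.mem_divisorsAntidiagonal, Finset.mem_product,
      mem_idealsOfNorm] at hx hx'
    simp only [Sigma.mk.injEq, heq_eq_eq] at h
    obtain ⟨hJ, rfl⟩ := h
    have hB0 : B ≠ 0 := by
      intro h0
      rw [h0, Ideal.zero_eq_bot, Ideal.absNorm_bot] at hx
      obtain ⟨⟨hab, -⟩, hB, -⟩ := hx
      exact hn (by rw [← hab, ← hB]; simp)
    have hA : A = A' := mul_left_cancel₀ hB0 hJ
    subst hA
    obtain ⟨⟨-, -⟩, hB, hA⟩ := hx
    obtain ⟨⟨-, -⟩, hB', hA'⟩ := hx'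
    simp [← hB, ← hB', ← hA, ← hA']
  · rintro ⟨J, B⟩ hy
    simp only [Finset.mem_sigma, mem_idealsOfNorm, hDv] at hy
    obtain ⟨hJn, hBmem⟩ := hy
    have hJ0 : J ≠ ⊥ := by rw [Ne, ← Ideal.absNorm_eq_zero_iff, hJn]; exact hn
    obtain ⟨A, rfl⟩ := (mem_filter_dvd_iff hJ0).1 hBmem
    refine ⟨⟨⟨Ideal.absNorm B, Ideal.absNorm A⟩, ⟨B, A⟩⟩, ?_, rfl⟩
    simp only [Finset.mem_sigma, Nat.mem_divisorsAntidiagonal, Finset.mem_product, mem_idealsOfNorm,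
      and_true, and_self]
    exact ⟨by rw [← map_mul, hJn], hn⟩
  · intro x _
    rfl

/-- `h_𝔠(n) = #{D : N(D) = n, every prime factor of D divides 𝔠}` as the cardinality of a filter of
`idealsOfNorm K n` (any decidability instance). [folklore] -/
theorem card_supported_eq_card_filter (𝔠 : Ideal (𝓞 K)) (n : ℕ)
    [DecidablePred fun D : Ideal (𝓞 K) ↦ ∀ P ∈ normalizedFactors D, P ∣ 𝔠] :
    Nat.card {D : Ideal (𝓞 K) // Ideal.absNorm D = n ∧ ∀ P ∈ normalizedFactors D, P ∣ 𝔠} =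
      ((idealsOfNorm K n).filter (fun D ↦ ∀ P ∈ normalizedFactors D, P ∣ 𝔠)).card := by
  rw [← Nat.card_eq_finsetCard]
  exact Nat.card_congr (Equiv.subtypeEquivRight fun D ↦ by rw [Finset.mem_filter, mem_idealsOfNorm])

open scoped Classical in
/-- **`a_𝔠 ⋆ c_K = h_𝔠`**: for a nonzero ideal `𝔠` and `n ≠ 0`,
`∑_{ab=n} a_𝔠(a) c_K(b) = h_𝔠(n)`, where `a_𝔠(n) = ∑_{N(B)=n, B+𝔠=(1)} μ(B)` and
`h_𝔠(n) = #{D : N(D) = n, every prime factor of D divides 𝔠}` (regrouping and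
`sum_filter_idealMoebius_eq`). [cite: HeathBrownActa2001, §8 p. 51] -/
theorem sum_divisorsAntidiagonal_coprimeMoebius_mul {𝔠 : Ideal (𝓞 K)} (h𝔠 : 𝔠 ≠ ⊥) {n : ℕ}
    (hn : n ≠ 0) :
    ∑ p ∈ n.divisorsAntidiagonal,
        (∑ B ∈ (idealsOfNorm K p.1).filter (fun B ↦ B ⊔ 𝔠 = ⊤), idealMoebius B) *
          (idealNormCount K p.2 : ℤ) =
      (Nat.card {D : Ideal (𝓞 K) //
        Ideal.absNorm D = n ∧ ∀ P ∈ normalizedFactors D, P ∣ 𝔠} : ℤ) := by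
  rw [card_supported_eq_card_filter]
  have hL : ∑ p ∈ n.divisorsAntidiagonal,
      (∑ B ∈ (idealsOfNorm K p.1).filter (fun B ↦ B ⊔ 𝔠 = ⊤), idealMoebius B) *
        (idealNormCount K p.2 : ℤ) =
      ∑ p ∈ n.divisorsAntidiagonal, ∑ B ∈ idealsOfNorm K p.1, ∑ A ∈ idealsOfNorm K p.2,
        (if B ⊔ 𝔠 = ⊤ then idealMoebius B else 0) := by
    refine Finset.sum_congr rfl fun p _ ↦ ?_
    rw [← card_idealsOfNorm, Finset.sum_filter, Finset.sum_mul]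
    refine Finset.sum_congr rfl fun B _ ↦ ?_
    rw [Finset.sum_const, nsmul_eq_mul, mul_comm]
  have key := sum_divisorsAntidiagonal_regroup (K := K)
    (fun J B ↦ if B ⊔ 𝔠 = ⊤ then idealMoebius B else 0) hn
  rw [hL, key, Finset.natCast_card_filter]
  refine Finset.sum_congr rfl fun J hJ ↦ ?_
  rw [mem_idealsOfNorm] at hJ
  have hJ0 : J ≠ ⊥ := by rw [Ne, ← Ideal.absNorm_eq_zero_iff, hJ]; exact hn
  rw [← Finset.sum_filter]
  convert sum_filter_idealMoebius_eq hJ0 h𝔠 (fun B ↦ mem_filter_dvd_iff hJ0) using 2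

/-! ## `L(a_𝔠, s) · ζ_K(s) = L(h_𝔠, s)` -/

open scoped Classical in
/-- `|a_𝔠(n)| ≤ c_K(n)`. [folklore] -/
theorem abs_coprimeMoebiusSum_le (𝔠 : Ideal (𝓞 K)) (n : ℕ) :
    |((∑ B ∈ (idealsOfNorm K n).filter (fun B ↦ B ⊔ 𝔠 = ⊤), idealMoebius B : ℤ) : ℝ)| ≤
      idealNormCount K n := by
  rw [Int.cast_sum, ← card_idealsOfNorm]
  refine (Finset.abs_sum_le_sum_abs _ _).trans ?_
  calc ∑ B ∈ (idealsOfNorm K n).filter (fun B ↦ B ⊔ 𝔠 = ⊤), |(idealMoebius B : ℝ)|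
      ≤ ∑ B ∈ (idealsOfNorm K n).filter (fun B ↦ B ⊔ 𝔠 = ⊤), (1 : ℝ) :=
        Finset.sum_le_sum fun B _ ↦ by exact_mod_cast abs_idealMoebius_le_one B
    _ ≤ ∑ B ∈ idealsOfNorm K n, (1 : ℝ) :=
        Finset.sum_le_sum_of_subset_of_nonneg (Finset.filter_subset _ _) fun _ _ _ ↦ zero_le_one
    _ = (idealsOfNorm K n).card := by simp

/-- `h_𝔠(n) ≤ c_K(n)`. [folklore] -/
theorem card_supported_le (𝔠 : Ideal (𝓞 K)) (n : ℕ) :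
    Nat.card {D : Ideal (𝓞 K) // Ideal.absNorm D = n ∧ ∀ P ∈ normalizedFactors D, P ∣ 𝔠} ≤
      idealNormCount K n := by
  classical
  rw [card_supported_eq_card_filter, ← card_idealsOfNorm]
  exact Finset.card_filter_le _ _

open scoped Classical in
/-- `∑ a_𝔠(n) n^{-s}` converges absolutely for `Re s > 1`. [folklore] -/
theorem LSeriesSummable_coprimeMoebiusSum (𝔠 : Ideal (𝓞 K)) {s : ℂ} (hs : 1 < s.re) :
    LSeriesSummable (fun n ↦ ((∑ B ∈ (idealsOfNorm K n).filter (fun B ↦ B ⊔ 𝔠 = ⊤),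
      idealMoebius B : ℤ) : ℂ)) s := by
  refine Summable.of_norm_bounded (LSeriesSummable_idealNormCount K hs).norm fun n ↦ ?_
  refine norm_term_le s ?_
  rw [Complex.norm_intCast, Complex.norm_natCast]
  exact abs_coprimeMoebiusSum_le 𝔠 n

/-- `∑ h_𝔠(n) n^{-s}` converges absolutely for `Re s > 1`. [folklore] -/
theorem LSeriesSummable_supportedCount (𝔠 : Ideal (𝓞 K)) {s : ℂ} (hs : 1 < s.re) :
    LSeriesSummable (fun n ↦ (Nat.card {D : Ideal (𝓞 K) //
      Ideal.absNorm D = n ∧ ∀ P ∈ normalizedFactors D, P ∣ 𝔠} : ℂ)) s := by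
  refine Summable.of_norm_bounded (LSeriesSummable_idealNormCount K hs).norm fun n ↦ ?_
  refine norm_term_le s ?_
  rw [Complex.norm_natCast, Complex.norm_natCast]
  exact_mod_cast card_supported_le 𝔠 n

open scoped Classical in
/-- **`(∑ a_𝔠(n) n^{-s}) · ζ_K(s) = ∑ h_𝔠(n) n^{-s}` for `Re s > 1`**: the Dirichlet series of
`μ` restricted to the ideals coprime to `𝔠` is `ζ_K(s)^{-1} ∏_{P ∣ 𝔠} (1 − N(P)^{-s})^{-1}`
(Heath-Brown p. 51: "`f(s) = ∑_{(B,C)=1} μ(B)N(B)^{-s} = ζ_K(s)^{-1}∏_{P∣C}(1 − N(P)^{-s})^{-1}`"), the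
right side being written through its coefficients `h_𝔠`. [cite: HeathBrownActa2001, §8 p. 51] -/
theorem LSeries_coprimeMoebiusSum_mul_dedekindZeta {𝔠 : Ideal (𝓞 K)} (h𝔠 : 𝔠 ≠ ⊥) {s : ℂ}
    (hs : 1 < s.re) :
    LSeries (fun n ↦ ((∑ B ∈ (idealsOfNorm K n).filter (fun B ↦ B ⊔ 𝔠 = ⊤),
        idealMoebius B : ℤ) : ℂ)) s * _root_.NumberField.dedekindZeta K s =
      LSeries (fun n ↦ (Nat.card {D : Ideal (𝓞 K) //
        Ideal.absNorm D = n ∧ ∀ P ∈ normalizedFactors D, P ∣ 𝔠} : ℂ)) s := by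
  rw [dedekindZeta_eq_LSeries, ← LSeries_convolution' (LSeriesSummable_coprimeMoebiusSum 𝔠 hs)
    (LSeriesSummable_idealNormCount K hs)]
  refine LSeries_congr (fun {n} hn ↦ ?_) s
  rw [convolution_def]
  have h := congrArg (fun z : ℤ ↦ (z : ℂ)) (sum_divisorsAntidiagonal_coprimeMoebius_mul (K := K) h𝔠 hn)
  simpa only [Int.cast_sum, Int.cast_mul, Int.cast_natCast] using h

/-! ## The size of `∑ h_𝔠(n) n^{-1/2}`: an Euler product over the primes below `𝔠` -/

/-- If a nonzero ideal `D` all of whose prime factors divide `𝔠 ≠ 0` has norm `n`, then every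
rational prime factor of `n` divides `N(𝔠)`. [folklore] -/
theorem absNorm_mem_factoredNumbers {𝔠 D : Ideal (𝓞 K)} (h𝔠 : 𝔠 ≠ ⊥) (hD : D ≠ ⊥)
    (hsupp : ∀ P ∈ normalizedFactors D, P ∣ 𝔠) :
    Ideal.absNorm D ∈ Nat.factoredNumbers (Ideal.absNorm 𝔠).primeFactors := by
  rw [Nat.mem_factoredNumbers']
  intro p hp hpn
  have hD0 : (D : Ideal (𝓞 K)) ≠ 0 := by rwa [Ne, Ideal.zero_eq_bot]
  have hc0 : Ideal.absNorm 𝔠 ≠ 0 := by rwa [Ne, Ideal.absNorm_eq_zero_iff]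
  have hprod : Ideal.absNorm D = ((normalizedFactors D).map Ideal.absNorm).prod := by
    conv_lhs => rw [← associated_iff_eq.1 (prod_normalizedFactors hD0)]
    rw [map_multiset_prod]
  rw [hprod] at hpn
  obtain ⟨m, hm, hpm⟩ := (Nat.prime_iff.1 hp).exists_mem_multiset_dvd hpn
  obtain ⟨Q, hQ, rfl⟩ := Multiset.mem_map.1 hm
  have hQc : Ideal.absNorm Q ∣ Ideal.absNorm 𝔠 := map_dvd Ideal.absNorm (hsupp Q hQ)
  exact Nat.mem_primeFactors.2 ⟨hp, hpm.trans hQc, hc0⟩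

/-- The local factors `∑_e c_K(p^e) (p^e)^{-1/2}` converge (`c_K(p^e) ≤ (e+1)^{[K:ℚ]}`,
`p^{-1/2} < 1`). [folklore] -/
theorem summable_localFactor {p : ℕ} (hp : p.Prime) :
    Summable fun e : ℕ ↦ (idealNormCount K (p ^ e) : ℝ) * ((p : ℝ) ^ e) ^ (-(1 / 2 : ℝ)) := by
  set d : ℕ := Module.finrank ℚ K
  set r : ℝ := (p : ℝ) ^ (-(1 / 2 : ℝ)) with hr
  have hp2 : (2 : ℝ) ≤ p := by exact_mod_cast hp.two_le
  have hr0 : 0 < r := Real.rpow_pos_of_pos (by linarith) _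
  have hr1 : r < 1 := Real.rpow_lt_one_of_one_lt_of_neg (by linarith) (by norm_num)
  have hg : Summable fun n : ℕ ↦ ((n : ℝ) ^ d * r ^ n) :=
    summable_pow_mul_geometric_of_norm_lt_one d (by rwa [Real.norm_of_nonneg hr0.le])
  have hg1 : Summable fun n : ℕ ↦ r⁻¹ * (((n + 1 : ℕ) : ℝ) ^ d * r ^ (n + 1)) :=
    ((summable_nat_add_iff 1).2 hg).mul_left r⁻¹
  refine Summable.of_nonneg_of_le (fun e ↦ by positivity) (fun e ↦ ?_) hg1
  have hce := idealNormCount_prime_pow_le K p e hp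
  have hpow : ((p : ℝ) ^ e) ^ (-(1 / 2 : ℝ)) = r ^ e := by
    rw [hr, ← Real.rpow_natCast, ← Real.rpow_mul (by linarith), mul_comm, Real.rpow_mul (by linarith),
      Real.rpow_natCast]
  rw [hpow]
  calc (idealNormCount K (p ^ e) : ℝ) * r ^ e ≤ ((e : ℝ) + 1) ^ d * r ^ e := by gcongr
    _ = r⁻¹ * (((e + 1 : ℕ) : ℝ) ^ d * r ^ (e + 1)) := by
        push_cast
        field_simp
        ring

open scoped Classical in
/-- **`∑_n h_𝔠(n) n^{-1/2} ≤ ∏_{p ∣ N(𝔠)} ∑_e c_K(p^e)(p^e)^{-1/2}`**: `h_𝔠(n) ≤ c_K(n)` and `h_𝔠` is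
supported on the numbers all of whose prime factors divide `N(𝔠)` (`absNorm_mem_factoredNumbers`),
so the sum is majorised by the finite Euler product of Mathlib's
`EulerProduct.summable_and_hasSum_factoredNumbers_prod_filter_prime_tsum` for the multiplicative
function `c_K(n) n^{-1/2}`. [folklore] -/
theorem tsum_norm_term_supportedCount_le {𝔠 : Ideal (𝓞 K)} (h𝔠 : 𝔠 ≠ ⊥) :
    (Summable fun n ↦ ‖term (fun n ↦ (Nat.card {D : Ideal (𝓞 K) //
        Ideal.absNorm D = n ∧ ∀ P ∈ normalizedFactors D, P ∣ 𝔠} : ℂ)) ((1 / 2 : ℝ) : ℂ) n‖) ∧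
    ∑' n, ‖term (fun n ↦ (Nat.card {D : Ideal (𝓞 K) //
        Ideal.absNorm D = n ∧ ∀ P ∈ normalizedFactors D, P ∣ 𝔠} : ℂ)) ((1 / 2 : ℝ) : ℂ) n‖ ≤
      ∏ p ∈ (Ideal.absNorm 𝔠).primeFactors,
        ∑' e : ℕ, (idealNormCount K (p ^ e) : ℝ) * ((p : ℝ) ^ e) ^ (-(1 / 2 : ℝ)) := by
  classical
  set S : Finset ℕ := (Ideal.absNorm 𝔠).primeFactors with hS
  set f : ℕ → ℝ := fun m ↦ (idealNormCount K m : ℝ) * (m : ℝ) ^ (-(1 / 2 : ℝ)) with hf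
  have hf1 : f 1 = 1 := by simp [hf, idealNormCount_one]
  have hmul : ∀ {m n : ℕ}, Nat.Coprime m n → f (m * n) = f m * f n := by
    intro m n hmn
    simp only [hf]
    rw [idealNormCount_mul_of_coprime K hmn, Nat.cast_mul, Nat.cast_mul,
      Real.mul_rpow (Nat.cast_nonneg _) (Nat.cast_nonneg _)]
    ring
  have hloc : ∀ {p : ℕ}, p.Prime → Summable fun e : ℕ ↦ ‖f (p ^ e)‖ := by
    intro p hp
    refine (summable_localFactor (K := K) hp).congr fun e ↦ ?_
    rw [hf, Real.norm_of_nonneg (by positivity)]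
    push_cast
    rfl
  obtain ⟨-, hsum⟩ :=
    EulerProduct.summable_and_hasSum_factoredNumbers_prod_filter_prime_tsum hf1 hmul hloc S
  have hfilter : S.filter Nat.Prime = S :=
    Finset.filter_true_of_mem fun p hp ↦ Nat.prime_of_mem_primeFactors hp
  rw [hfilter] at hsum
  -- the indicator majorant
  have hind : HasSum ((Nat.factoredNumbers S).indicator f) (∏ p ∈ S, ∑' e : ℕ, f (p ^ e)) :=
    hasSum_subtype_iff_indicator.1 hsum
  have hle : ∀ n, ‖term (fun n ↦ (Nat.card {D : Ideal (𝓞 K) //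
      Ideal.absNorm D = n ∧ ∀ P ∈ normalizedFactors D, P ∣ 𝔠} : ℂ)) ((1 / 2 : ℝ) : ℂ) n‖ ≤
      (Nat.factoredNumbers S).indicator f n := by
    intro n
    rcases eq_or_ne n 0 with rfl | hn
    · rw [term_zero, norm_zero]
      exact Set.indicator_nonneg (fun m _ ↦ by simp only [hf]; positivity) _
    rw [norm_term_eq, if_neg hn, Complex.norm_natCast]
    simp only [Complex.ofReal_re]
    by_cases hmem : n ∈ Nat.factoredNumbers S
    · rw [Set.indicator_of_mem hmem, hf]
      simp only
      rw [Real.rpow_neg (Nat.cast_nonneg n), ← div_eq_mul_inv]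
      gcongr
      exact_mod_cast card_supported_le 𝔠 n
    · rw [Set.indicator_of_notMem hmem]
      have h0 : Nat.card {D : Ideal (𝓞 K) //
          Ideal.absNorm D = n ∧ ∀ P ∈ normalizedFactors D, P ∣ 𝔠} = 0 := by
        rw [Nat.card_eq_zero]
        left
        refine ⟨fun ⟨D, hD, hsupp⟩ ↦ ?_⟩
        have hD0 : D ≠ ⊥ := by rw [Ne, ← Ideal.absNorm_eq_zero_iff, hD]; exact hn
        exact hmem (hD ▸ absNorm_mem_factoredNumbers h𝔠 hD0 hsupp)
      rw [h0]
      simp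
  have hsumm : Summable fun n ↦ ‖term (fun n ↦ (Nat.card {D : Ideal (𝓞 K) //
      Ideal.absNorm D = n ∧ ∀ P ∈ normalizedFactors D, P ∣ 𝔠} : ℂ)) ((1 / 2 : ℝ) : ℂ) n‖ :=
    Summable.of_nonneg_of_le (fun n ↦ norm_nonneg _) hle hind.summable
  refine ⟨hsumm, ?_⟩
  calc _ ≤ ∑' n, (Nat.factoredNumbers S).indicator f n :=
        Summable.tsum_le_tsum hle hsumm hind.summable
    _ = ∏ p ∈ S, ∑' e : ℕ, f (p ^ e) := hind.tsum_eq
    _ = _ := by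
        refine Finset.prod_congr rfl fun p _ ↦ tsum_congr fun e ↦ ?_
        simp only [hf]
        push_cast
        rfl

/-! ## `∑ h_𝔠(n) n^{-σ}` as a finite Euler product, and the Möbius sums coprime to `𝔠` -/

/-- **`∑_n h_T(n) n^{-σ} = ∏_{P ∈ T} (1 − N(P)^{-σ})^{-1}`** for a finite set `T` of prime ideals and
`σ > 0`, `h_T(n) = #{D : N(D) = n, D ≠ 0, supp D ⊆ T}` (regroup `hasSum_absNorm_rpow_neg_supported`
by norm, `HasSum.tsum_fiberwise`). [folklore] -/
theorem hasSum_card_supported_mul_rpow {σ : ℝ} (hσ : 0 < σ) (T : Finset (Ideal (𝓞 K)))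
    (hT : ∀ P ∈ T, Prime P) :
    HasSum (fun n : ℕ ↦ (Nat.card {D : Ideal (𝓞 K) //
        Ideal.absNorm D = n ∧ (D ≠ ⊥ ∧ ∀ Q ∈ normalizedFactors D, Q ∈ T)} : ℝ) * (n : ℝ) ^ (-σ))
      (∏ P ∈ T, (1 - (Ideal.absNorm P : ℝ) ^ (-σ))⁻¹) := by
  have h := (hasSum_absNorm_rpow_neg_supported hσ T hT).tsum_fiberwise
    (fun D : Supp[T] ↦ Ideal.absNorm (D : Ideal (𝓞 K)))
  -- the fibre over `n` is the finite set of `T`-supported ideals of norm `n`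
  have key : ∀ n : ℕ, (Nat.card {D : Ideal (𝓞 K) //
      Ideal.absNorm D = n ∧ (D ≠ ⊥ ∧ ∀ Q ∈ normalizedFactors D, Q ∈ T)} : ℝ) * (n : ℝ) ^ (-σ) =
      ∑' b : ↥((fun D : Supp[T] ↦ Ideal.absNorm (D : Ideal (𝓞 K))) ⁻¹' {n}),
        (Ideal.absNorm ((b : Supp[T]) : Ideal (𝓞 K)) : ℝ) ^ (-σ) := by
    intro n
    have hterm : ∀ b : ↥((fun D : Supp[T] ↦ Ideal.absNorm (D : Ideal (𝓞 K))) ⁻¹' {n}),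
        (Ideal.absNorm ((b : Supp[T]) : Ideal (𝓞 K)) : ℝ) ^ (-σ) = (n : ℝ) ^ (-σ) := by
      rintro ⟨b, hb⟩
      rw [Set.mem_preimage, Set.mem_singleton_iff] at hb
      simp [hb]
    rw [tsum_congr hterm, tsum_const, nsmul_eq_mul]
    congr 1
    rw [Nat.cast_inj]
    refine Nat.card_congr ?_
    refine (Equiv.subtypeEquivRight (fun D ↦ ?_)).trans
      (Equiv.subtypeSubtypeEquivSubtypeInter
        (fun D : Ideal (𝓞 K) ↦ D ≠ ⊥ ∧ ∀ Q ∈ normalizedFactors D, Q ∈ T)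
        (fun D ↦ Ideal.absNorm D = n)).symm
    tauto
  rw [show (fun n : ℕ ↦ (Nat.card {D : Ideal (𝓞 K) //
      Ideal.absNorm D = n ∧ (D ≠ ⊥ ∧ ∀ Q ∈ normalizedFactors D, Q ∈ T)} : ℝ) * (n : ℝ) ^ (-σ)) =
      fun n ↦ ∑' b : ↥((fun D : Supp[T] ↦ Ideal.absNorm (D : Ideal (𝓞 K))) ⁻¹' {n}),
        (Ideal.absNorm ((b : Supp[T]) : Ideal (𝓞 K)) : ℝ) ^ (-σ) from funext key]
  exact h

/-- The two descriptions of the `𝔠`-supported ideals of norm `n` agree: "every prime factor divides `𝔠`"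
versus "nonzero with all normalized factors among those of `𝔠`". [folklore] -/
theorem card_supported_eq {𝔠 : Ideal (𝓞 K)} (h𝔠 : 𝔠 ≠ ⊥) {n : ℕ} (hn : n ≠ 0) :
    Nat.card {D : Ideal (𝓞 K) // Ideal.absNorm D = n ∧ ∀ P ∈ normalizedFactors D, P ∣ 𝔠} =
      Nat.card {D : Ideal (𝓞 K) // Ideal.absNorm D = n ∧
        (D ≠ ⊥ ∧ ∀ Q ∈ normalizedFactors D, Q ∈ (normalizedFactors 𝔠).toFinset)} := by
  have h𝔠0 : (𝔠 : Ideal (𝓞 K)) ≠ 0 := by rwa [Ne, Ideal.zero_eq_bot]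
  refine Nat.card_congr (Equiv.subtypeEquivRight fun D ↦ ?_)
  constructor
  · rintro ⟨hDn, hsupp⟩
    refine ⟨hDn, ?_, fun Q hQ ↦ ?_⟩
    · rw [Ne, ← Ideal.absNorm_eq_zero_iff, hDn]; exact hn
    · rw [Multiset.mem_toFinset, UniqueFactorizationMonoid.mem_normalizedFactors_iff h𝔠0]
      exact ⟨prime_of_normalized_factor Q hQ, hsupp Q hQ⟩
  · rintro ⟨hDn, -, hsupp⟩
    refine ⟨hDn, fun Q hQ ↦ ?_⟩
    have := hsupp Q hQ
    rw [Multiset.mem_toFinset, UniqueFactorizationMonoid.mem_normalizedFactors_iff h𝔠0] at this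
    exact this.2

/-- **`∑_n h_𝔠(n)/n = ∏_{P ∣ 𝔠} (1 − N(P)^{-1})^{-1}`** — the value at `s = 1` of the numerator
`H = ∑ h_𝔠(n) n^{-s}` of `∑_{(B,𝔠)=1} μ(B)N(B)^{-s} = H(s)/ζ_K(s)` (Heath-Brown p. 51: "The residue is
easily found to be `γ₀^{-1}∏_{P∣C}(1 − N(P)^{-1})^{-1}`"), as a complex `L`-series value.
[cite: HeathBrownActa2001, §8 p. 51] -/
theorem LSeries_supportedCount_one {𝔠 : Ideal (𝓞 K)} (h𝔠 : 𝔠 ≠ ⊥) :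
    LSeries (fun n ↦ (Nat.card {D : Ideal (𝓞 K) //
        Ideal.absNorm D = n ∧ ∀ P ∈ normalizedFactors D, P ∣ 𝔠} : ℂ)) 1 =
      ((∏ P ∈ (normalizedFactors 𝔠).toFinset, (1 - (Ideal.absNorm P : ℝ)⁻¹)⁻¹ : ℝ) : ℂ) := by
  have hT : ∀ P ∈ (normalizedFactors 𝔠).toFinset, Prime P := fun P hP ↦
    prime_of_normalized_factor P (Multiset.mem_toFinset.1 hP)
  have hsum := hasSum_card_supported_mul_rpow (K := K) one_pos _ hT
  have h1 : LSeries (fun n ↦ (Nat.card {D : Ideal (𝓞 K) //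
      Ideal.absNorm D = n ∧ ∀ P ∈ normalizedFactors D, P ∣ 𝔠} : ℂ)) 1 =
      LSeries (fun n ↦ ((Nat.card {D : Ideal (𝓞 K) //
        Ideal.absNorm D = n ∧ ∀ P ∈ normalizedFactors D, P ∣ 𝔠} : ℕ) : ℂ)) ((1 : ℝ) : ℂ) := by
    push_cast; rfl
  rw [h1, LSeries_natCast_ofReal _ one_pos]
  congr 1
  simp only [Real.rpow_neg_one] at hsum
  rw [← hsum.tsum_eq]
  refine tsum_congr fun n ↦ ?_
  rcases eq_or_ne n 0 with rfl | hn
  · simp [LogEulerProduct.term_zero one_pos]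
  · rw [LogEulerProduct.term, card_supported_eq h𝔠 hn, Real.rpow_neg_one]

open scoped Classical in
/-- Regrouping the `ℕ`-grouped coprime Möbius sum as a sum over ideals:
`∑_{1 ≤ n ≤ N} a_𝔠(n) g(n) = ∑_{1 ≤ N(B) ≤ N, B + 𝔠 = (1)} μ(B) g(N(B))`. [folklore] -/
theorem sum_Icc_coprimeMoebiusSum_mul_eq {M : Type*} [AddCommMonoid M] [Module ℤ M]
    (𝔠 : Ideal (𝓞 K)) (g : ℕ → M) (N : ℕ) :
    ∑ n ∈ Finset.Icc 1 N, (∑ B ∈ (idealsOfNorm K n).filter (fun B ↦ B ⊔ 𝔠 = ⊤), idealMoebius B) • g n =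
      ∑ B ∈ ((Finset.Icc 1 N).biUnion (idealsOfNorm K)).filter (fun B ↦ B ⊔ 𝔠 = ⊤),
        idealMoebius B • g (Ideal.absNorm B) := by
  rw [Finset.filter_biUnion, Finset.sum_biUnion]
  · refine Finset.sum_congr rfl fun n _ ↦ ?_
    rw [Finset.sum_smul]
    refine Finset.sum_congr rfl fun B hB ↦ ?_
    rw [Finset.mem_filter, mem_idealsOfNorm] at hB
    rw [hB.1]
  · intro a _ b _ hab
    refine Finset.disjoint_left.2 fun J ha hb ↦ hab ?_
    rw [Finset.mem_filter, mem_idealsOfNorm] at ha hb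
    rw [← ha.1, ← hb.1]

open scoped Classical in
/-- **Möbius sums over the ideals coprime to `𝔠`, with de la Vallée-Poussin error term** — the sum
`Σ` of Heath-Brown's (8.7) for a general number field `K` (Acta Math. 186 (2001), p. 51:
"`Σ = ∑_{N(B)<x, (B,C)=1} μ(B)N(B)^{-1}log(x/N(B))` … using the standard zero-free region for `ζ_K(s)` we
may therefore change the path of integration in the usual way to obtain
`Σ = res{f(s+1)x^s s^{-2} : s = 0} + O(exp{−c√(log x)})` for a suitable constant `c`, whenever
`N(C) ≤ x`. The residue is easily found to be `γ₀^{-1}∏_{P∣C}(1 − N(P)^{-1})^{-1}`").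
PROVED, in the following uniform form: there are `c > 0`, `C > 0` depending only on `K` such that
for every nonzero ideal `𝔠` and every `x ≥ 1`,
`|∑_{n ≤ x} a_𝔠(n) n^{-1} log(x/n) − ρ_K^{-1}∏_{P ∣ 𝔠}(1 − N(P)^{-1})^{-1}| ≤ C · B(𝔠) · exp(−c√(log x))`,
`a_𝔠(n) = ∑_{N(B)=n, B+𝔠=(1)} μ(B)` (so the sum is `∑_{N(B) ≤ x, (B,𝔠)=1} μ(B)N(B)^{-1}log(x/N(B))`,
`sum_Icc_coprimeMoebiusSum_mul_eq`), with
`B(𝔠) = ∏_{p ∣ N(𝔠)} ∑_e c_K(p^e) p^{-e/2} ≤ A_K^{ω(N(𝔠))}` (`prod_localFactor_le_pow`). From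
`logRieszMean_LSeries_div_dedekindZeta_bound` (`σ_h = 1/2`, `H = ∑ h_𝔠(n)n^{-s}`) with
`LSeries_coprimeMoebiusSum_mul_dedekindZeta`, `tsum_norm_term_supportedCount_le`,
`LSeries_supportedCount_one`. [cite: HeathBrownActa2001, §8 p. 51] -/
theorem coprimeMoebius_logRieszMean_bound :
    ∃ c : ℝ, 0 < c ∧ ∃ C : ℝ, 0 < C ∧ ∀ 𝔠 : Ideal (𝓞 K), 𝔠 ≠ ⊥ → ∀ x : ℝ, 1 ≤ x →
      ‖(∑ n ∈ Finset.Icc 1 ⌊x⌋₊,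
          ((∑ B ∈ (idealsOfNorm K n).filter (fun B ↦ B ⊔ 𝔠 = ⊤), idealMoebius B : ℤ) : ℂ) / n *
            (Real.log (x / n) : ℂ)) -
          ((∏ P ∈ (normalizedFactors 𝔠).toFinset, (1 - (Ideal.absNorm P : ℝ)⁻¹)⁻¹ : ℝ) : ℂ) /
            (_root_.NumberField.dedekindZeta_residue K : ℂ)‖ ≤
        C * (∏ p ∈ (Ideal.absNorm 𝔠).primeFactors,
              ∑' e : ℕ, (idealNormCount K (p ^ e) : ℝ) * ((p : ℝ) ^ e) ^ (-(1 / 2 : ℝ))) *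
          Real.exp (-c * Real.sqrt (Real.log x)) := by
  obtain ⟨c, hc, C, hC, h⟩ :=
    logRieszMean_LSeries_div_dedekindZeta_bound K (σₕ := 1 / 2) (by norm_num)
  refine ⟨c, hc, C, hC, fun 𝔠 h𝔠 x hx ↦ ?_⟩
  obtain ⟨hhs, hhB⟩ := tsum_norm_term_supportedCount_le (K := K) h𝔠
  have hhs' : LSeriesSummable (fun n ↦ (Nat.card {D : Ideal (𝓞 K) //
      Ideal.absNorm D = n ∧ ∀ P ∈ normalizedFactors D, P ∣ 𝔠} : ℂ)) ((1 / 2 : ℝ) : ℂ) :=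
    hhs.of_norm
  have := h (fun n ↦ ((∑ B ∈ (idealsOfNorm K n).filter (fun B ↦ B ⊔ 𝔠 = ⊤),
      idealMoebius B : ℤ) : ℂ))
    (fun n ↦ (Nat.card {D : Ideal (𝓞 K) //
      Ideal.absNorm D = n ∧ ∀ P ∈ normalizedFactors D, P ∣ 𝔠} : ℂ)) _ hhs' hhB
    (fun σ hσ ↦ LSeriesSummable_coprimeMoebiusSum 𝔠 (by simpa using hσ))
    (fun s hs ↦ LSeries_coprimeMoebiusSum_mul_dedekindZeta h𝔠 hs) x hx
  rwa [LSeries_supportedCount_one h𝔠] at this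

/-- A uniform bound for the local factors: `∑_e c_K(p^e)(p^e)^{-1/2} ≤ A_K := ∑_e (e+1)^{[K:ℚ]} 2^{-e/2}`
for every prime `p` (`c_K(p^e) ≤ (e+1)^{[K:ℚ]}`, `p ≥ 2`). [folklore] -/
theorem localFactor_le {p : ℕ} (hp : p.Prime) :
    (Summable fun e : ℕ ↦ ((e : ℝ) + 1) ^ Module.finrank ℚ K * ((Real.sqrt 2)⁻¹) ^ e) ∧
    ∑' e : ℕ, (idealNormCount K (p ^ e) : ℝ) * ((p : ℝ) ^ e) ^ (-(1 / 2 : ℝ)) ≤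
      ∑' e : ℕ, ((e : ℝ) + 1) ^ Module.finrank ℚ K * ((Real.sqrt 2)⁻¹) ^ e := by
  set d : ℕ := Module.finrank ℚ K
  set r : ℝ := (Real.sqrt 2)⁻¹ with hr
  have hr0 : 0 < r := by positivity
  have hr1 : r < 1 := by
    rw [hr, inv_lt_one_iff₀]; right
    rw [Real.lt_sqrt (by norm_num)]; norm_num
  have hg : Summable fun n : ℕ ↦ ((n : ℝ) ^ d * r ^ n) :=
    summable_pow_mul_geometric_of_norm_lt_one d (by rwa [Real.norm_of_nonneg hr0.le])
  have hA : Summable fun e : ℕ ↦ ((e : ℝ) + 1) ^ d * r ^ e := by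
    have hg1 : Summable fun n : ℕ ↦ r⁻¹ * (((n + 1 : ℕ) : ℝ) ^ d * r ^ (n + 1)) :=
      ((summable_nat_add_iff 1).2 hg).mul_left r⁻¹
    refine hg1.congr fun e ↦ ?_
    push_cast
    field_simp
    ring
  refine ⟨hA, Summable.tsum_le_tsum (fun e ↦ ?_) (summable_localFactor (K := K) hp) hA⟩
  have hp2 : (2 : ℝ) ≤ p := by exact_mod_cast hp.two_le
  have hce := idealNormCount_prime_pow_le K p e hp
  have hpow : ((p : ℝ) ^ e) ^ (-(1 / 2 : ℝ)) ≤ r ^ e := by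
    rw [← Real.rpow_natCast, ← Real.rpow_mul (by linarith), mul_comm, Real.rpow_mul (by linarith),
      Real.rpow_natCast]
    refine pow_le_pow_left₀ (Real.rpow_nonneg (by linarith) _) ?_ e
    rw [hr, Real.sqrt_eq_rpow, ← Real.rpow_neg_one, ← Real.rpow_mul (by norm_num)]
    norm_num
    exact Real.rpow_le_rpow_of_nonpos (by norm_num) hp2 (by norm_num)
  calc (idealNormCount K (p ^ e) : ℝ) * ((p : ℝ) ^ e) ^ (-(1 / 2 : ℝ))
      ≤ ((e : ℝ) + 1) ^ d * r ^ e := by gcongr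

/-- Consequently `B(𝔠) ≤ A_K^{ω(N(𝔠))}`, `ω(N(𝔠))` the number of rational primes dividing `N(𝔠)`.
[folklore] -/
theorem prod_localFactor_le_pow (𝔠 : Ideal (𝓞 K)) :
    ∏ p ∈ (Ideal.absNorm 𝔠).primeFactors,
        ∑' e : ℕ, (idealNormCount K (p ^ e) : ℝ) * ((p : ℝ) ^ e) ^ (-(1 / 2 : ℝ)) ≤
      (∑' e : ℕ, ((e : ℝ) + 1) ^ Module.finrank ℚ K * ((Real.sqrt 2)⁻¹) ^ e) ^
        (Ideal.absNorm 𝔠).primeFactors.card := by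
  rw [← Finset.prod_const]
  refine Finset.prod_le_prod (fun p _ ↦ tsum_nonneg fun e ↦ by positivity) fun p hp ↦ ?_
  exact (localFactor_le (K := K) (Nat.prime_of_mem_primeFactors hp)).2

end NumberField

end Literature.NumberTheory.LFunctions

end
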